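import Summits.KontsevichZagierPeriods.KontsevichZagierPeriods.Theorems.HurwitzMicroSectorsNormalFormPrincipleLevelKMergeAndSwap
import Summits.KontsevichZagierPeriods.KontsevichZagierPeriods.Theorems.HurwitzMicroSectorsNormalFormPrincipleLevelKTriangleSubDimOne
import Summits.KontsevichZagierPeriods.KontsevichZagierPeriods.Theorems.HurwitzMicroSectorsNormalFormPrincipleLevelKExistsReps
import Summits.KontsevichZagierPeriods.KontsevichZagierPeriods.Theorems.HurwitzMicroSectorsNormalFormPrincipleLevelKDimOneIsRational
import Summits.KontsevichZagierPeriods.KontsevichZagierPeriods.Theorems.HurwitzMicroSectorsNormalFormPrincipleLevelKPowerSubstitution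
import Summits.KontsevichZagierPeriods.KontsevichZagierPeriods.Theorems.HurwitzMicroSectorsNormalFormPrincipleDimOneAssembly

/-!
# `NormalFormPrinciple` (stmt-KontsevichZagierPeriods-3869), line `SketchIdeator1` — leaf `stub_boxRigidity`:
# WEIGHT TWO, ALL LEVELS, OFF RESONANCE: Conjecture 1 (kernel form), unconditionally

The boxes `[(0,1)², c x^a y^b/(1 − x^{k₁} y^{k₂})]`, `c ∈ ℚ`, `k₁, k₂ ≥ 1`, OFF RESONANCE:
`(a+1) k₂ ≠ (b+1) k₁`. Their values `c/(k₁k₂)·(ψ(θ₂) − ψ(θ₁))/(θ₂ − θ₁)` (`θ₁ = (a+1)/k₁`,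
`θ₂ = (b+1)/k₂`) lie in the Baker module `ℚ̄ + ℚ̄π + Σ ℚ̄ log ℚ̄` (Gauss' digamma theorem); the
RESONANT boxes `θ₁ = θ₂` are, after the power substitution, exactly the route's diagonal SECTORS
`P(xy)/(1 − (xy)^K)` (values `ζ(2, θ)`: `π²` for `2θ ∈ ℤ`, `L(2,χ₋₃)`-type for `6θ ∈ ℤ`, Catalan for
`4θ ∈ ℤ`, …, each rung with its own independence input) — this file is their COMPLEMENT in weight two
and needs no input beyond Baker's theorem, which the tree proves.

Chain of moves per box (`offres_sub_dimOne`): the power substitution `(X,Y) ↦ (X^{k₂}, Y^{k₁})`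
(rule 2, `power_substitution`) makes the level `(K,K)`, `K = k₁k₂`, with exponents
`A = (a+1)k₂ − 1 ≠ B = (b+1)k₁ − 1`; after a swap (rule 2) `B < A`; the merge `u = xy` (rule 2,
`levelK_merge_and_swap`) gives the triangle `{0<x<1, 0≤u≤x}` with integrand `c x^{A−B−1} u^B/(1−u^K)`;
integrating out `x` (rule 3, `levelK_triangle_sub_dimOne`) gives
`[(0,1), (c/(A−B)) (u^B − u^A)/(1 − u^K)]`, a representation of KZ's RATIONAL shape in dimension one
(`levelK_dimOne_isRational`). Hence the subgroup generated by the off-resonance boxes and all rational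
representations of dimension `≤ 1` is congruent modulo relations to the latter alone, on which seat
c4's kernel theorem `Dlog.mem_relations_of_eval_eq_zero_of_dim_le_one` (Baker) applies:
CONJECTURE 1 OF KONTSEVICH–ZAGIER HOLDS, IN KERNEL FORM, ON THIS LAYER UNCONDITIONALLY
(`offres_mem_relations_of_eval_eq_zero_of_mem_closure`); e.g. `∫∫_{(0,1)²} dxdy/(1 − xy²) = 2 log 2`
against `∫_1^4 dt/t` (`offres_equivalent_dimLeOne_of_value_eq`).
References: M. Kontsevich, D. Zagier, *Periods* (2001), §1.2 Conjecture 1; A. Baker, *Transcendental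
Number Theory* (1975), Thm. 2.1 (as landed in the tree). No new definitions.
-/

noncomputable section

open MeasureTheory Set
open Literature.NumberTheory.Transcendental Literature.NumberTheory.Transcendental.KZ
open Literature.ModelTheory.ExponentialFields (IsSemialgebraic)

namespace Summit.KontsevichZagierPeriods.HurwitzMicroSectors.NormalFormPrinciple.PiBox.LevelK


open Summit.KontsevichZagierPeriods.HurwitzMicroSectors.NormalFormPrinciple.PiBox.Dlog
  (mem_relations_of_eval_eq_zero_of_dim_le_one)

/-- **Off the diagonal, `b < a`**: the level-`K` monomial box `[(0,1)², c x^a y^b/(1 − x^K y^K)]`,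
`c ∈ ℚ`, differs by a relation from a RATIONAL representation of dimension one (merge → triangle →
integrate out). [cite: KontsevichZagier2001, §1.2] -/
theorem offdiag_sub_dimOne_of_lt (K : ℕ) (hK : 0 < K) (a b : ℕ) (hab : b < a) (c : ℚ)
    (N : IntegralRep 2) (hNd : N.domain = {x | ∀ i, x i ∈ Set.Ioo (0:ℝ) 1})
    (hNi : EqOn N.integrand (fun x => (c : ℝ) * (x 0 ^ a * x 1 ^ b) / (1 - x 0 ^ K * x 1 ^ K)) N.domain) :
    ∃ N₁ : IntegralRep 1, N₁.IsRational ∧ of N - of N₁ ∈ relations := by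
  have hc : IsAlgebraic ℚ (c : ℝ) := isAlgebraic_algebraMap c
  obtain ⟨-, hexR, hexN₁⟩ := levelK_exists_reps K hK (c : ℝ) hc
  obtain ⟨R, hRd, hRi⟩ := hexR a b hab
  obtain ⟨N₁, hN₁d, hN₁i⟩ := hexN₁ a b
  have e1 := (levelK_merge_and_swap K hK a b (c : ℝ) hc).1 hab N R hNd hNi hRd (hRi ▸ fun _ _ => rfl)
  have e2 := levelK_triangle_sub_dimOne K hK a b (c : ℝ) hc hab R N₁ hRd (hRi ▸ fun _ _ => rfl) hN₁d
    (hN₁i ▸ fun _ _ => rfl)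
  refine ⟨N₁, levelK_dimOne_isRational K hK a b c N₁ hN₁d (hN₁i ▸ fun _ _ => rfl), ?_⟩
  have e : of N - of N₁ = (of N - of R) + (of R - of N₁) := by abel
  rw [e]
  exact relations.add_mem e1 e2

/-- **Off the diagonal** (`a ≠ b`; swap first if `a < b`). [cite: KontsevichZagier2001, §1.2] -/
theorem offdiag_sub_dimOne (K : ℕ) (hK : 0 < K) (a b : ℕ) (hab : a ≠ b) (c : ℚ)
    (N : IntegralRep 2) (hNd : N.domain = {x | ∀ i, x i ∈ Set.Ioo (0:ℝ) 1})
    (hNi : EqOn N.integrand (fun x => (c : ℝ) * (x 0 ^ a * x 1 ^ b) / (1 - x 0 ^ K * x 1 ^ K)) N.domain) :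
    ∃ N₁ : IntegralRep 1, N₁.IsRational ∧ of N - of N₁ ∈ relations := by
  rcases lt_or_gt_of_ne hab with h | h
  · have hc : IsAlgebraic ℚ (c : ℝ) := isAlgebraic_algebraMap c
    obtain ⟨hexN, -, -⟩ := levelK_exists_reps K hK (c : ℝ) hc
    obtain ⟨N', hN'd, hN'i⟩ := hexN b a
    have e0 := (levelK_merge_and_swap K hK a b (c : ℝ) hc).2 N N' hNd hNi hN'd (hN'i ▸ fun _ _ => rfl)
    obtain ⟨N₁, hr, e⟩ := offdiag_sub_dimOne_of_lt K hK b a h c N' hN'd (hN'i ▸ fun _ _ => rfl)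
    refine ⟨N₁, hr, ?_⟩
    have e' : of N - of N₁ = (of N - of N') + (of N' - of N₁) := by abel
    rw [e']
    exact relations.add_mem e0 e
  · exact offdiag_sub_dimOne_of_lt K hK a b h c N hNd hNi

/-- **Off resonance, any level `(k₁, k₂)`**: the box `[(0,1)², c x^a y^b/(1 − x^{k₁} y^{k₂})]`,
`(a+1)k₂ ≠ (b+1)k₁`, `c ∈ ℚ`, differs by a relation from a rational representation of dimension one
(power substitution `(X,Y) ↦ (X^{k₂}, Y^{k₁})` to level `(k₁k₂, k₁k₂)`, then `offdiag_sub_dimOne`).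
[cite: KontsevichZagier2001, §1.2] -/
theorem offres_sub_dimOne (k₁ k₂ : ℕ) (hk₁ : 0 < k₁) (hk₂ : 0 < k₂) (a b : ℕ)
    (hres : (a + 1) * k₂ ≠ (b + 1) * k₁) (c : ℚ) (N : IntegralRep 2)
    (hNd : N.domain = {x | ∀ i, x i ∈ Set.Ioo (0:ℝ) 1})
    (hNi : EqOn N.integrand (fun x => (c : ℝ) * (x 0 ^ a * x 1 ^ b) / (1 - x 0 ^ k₁ * x 1 ^ k₂)) N.domain) :
    ∃ N₁ : IntegralRep 1, N₁.IsRational ∧ of N - of N₁ ∈ relations := by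
  have hc : IsAlgebraic ℚ (c : ℝ) := isAlgebraic_algebraMap c
  have hK : 0 < k₁ * k₂ := Nat.mul_pos hk₁ hk₂
  obtain ⟨hexN, -, -⟩ := levelK_exists_reps (k₁ * k₂) hK ((c * (k₂ * k₁ : ℕ) : ℚ) : ℝ)
    (isAlgebraic_algebraMap _)
  obtain ⟨N', hN'd, hN'i⟩ := hexN ((a + 1) * k₂ - 1) ((b + 1) * k₁ - 1)
  have e0 := power_substitution k₂ k₁ hk₂ hk₁ k₁ k₂ hk₁ hk₂ (c : ℝ) hc a b N N' hNd hNi hN'd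
    (fun x _ => by rw [hN'i, Nat.mul_comm k₂ k₁]; push_cast; ring)
  have hAB : (a + 1) * k₂ - 1 ≠ (b + 1) * k₁ - 1 := by
    have h1 : 0 < (a + 1) * k₂ := Nat.mul_pos (Nat.succ_pos a) hk₂
    have h2 : 0 < (b + 1) * k₁ := Nat.mul_pos (Nat.succ_pos b) hk₁
    omega
  obtain ⟨N₁, hr, e⟩ := offdiag_sub_dimOne (k₁ * k₂) hK _ _ hAB (c * (k₂ * k₁ : ℕ)) N' hN'd
    (hN'i ▸ fun _ _ => rfl)
  refine ⟨N₁, hr, ?_⟩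
  have e' : of N - of N₁ = (of N - of N') + (of N' - of N₁) := by abel
  rw [e']
  exact relations.add_mem e0 e

/-- Every element of the subgroup generated by the off-resonance boxes and the rational
representations of dimension `≤ 1` is congruent modulo relations to an element of the subgroup
generated by the latter alone. [cite: KontsevichZagier2001, §1.2] -/
theorem exists_mem_dimLeOneClosure_of_mem_offresClosure {x : FormalRep}
    (hx : x ∈ AddSubgroup.closure
      ({y : FormalRep | ∃ (k₁ k₂ a b : ℕ) (c : ℚ) (N : IntegralRep 2), 0 < k₁ ∧ 0 < k₂ ∧
          (a + 1) * k₂ ≠ (b + 1) * k₁ ∧ N.domain = {x | ∀ i, x i ∈ Set.Ioo (0:ℝ) 1} ∧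
          EqOn N.integrand (fun x => (c : ℝ) * (x 0 ^ a * x 1 ^ b) / (1 - x 0 ^ k₁ * x 1 ^ k₂))
            N.domain ∧ y = of N} ∪
       {y : FormalRep | ∃ (m : ℕ) (N : IntegralRep m), m ≤ 1 ∧ N.IsRational ∧ y = of N})) :
    ∃ x' ∈ AddSubgroup.closure
        {y : FormalRep | ∃ (m : ℕ) (N : IntegralRep m), m ≤ 1 ∧ N.IsRational ∧ y = of N},
      x - x' ∈ relations := by
  induction hx using AddSubgroup.closure_induction with
  | mem y hy =>
    rcases hy with hy | hy
    · obtain ⟨k₁, k₂, a, b, c, N, hk₁, hk₂, hres, hNd, hNi, rfl⟩ := hy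
      obtain ⟨N₁, hr, e⟩ := offres_sub_dimOne k₁ k₂ hk₁ hk₂ a b hres c N hNd hNi
      exact ⟨of N₁, AddSubgroup.subset_closure ⟨1, N₁, le_rfl, hr, rfl⟩, e⟩
    · exact ⟨y, AddSubgroup.subset_closure hy, by simp [relations.zero_mem]⟩
  | zero => exact ⟨0, AddSubgroup.zero_mem _, by simp [relations.zero_mem]⟩
  | add y z _ _ ihy ihz =>
    obtain ⟨y', hy', ey⟩ := ihy
    obtain ⟨z', hz', ez⟩ := ihz
    refine ⟨y' + z', AddSubgroup.add_mem _ hy' hz', ?_⟩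
    have e : y + z - (y' + z') = (y - y') + (z - z') := by abel
    rw [e]
    exact relations.add_mem ey ez
  | neg y _ ihy =>
    obtain ⟨y', hy', ey⟩ := ihy
    refine ⟨-y', AddSubgroup.neg_mem _ hy', ?_⟩
    have e : -y - -y' = -(y - y') := by abel
    rw [e]
    exact relations.neg_mem ey

/-- **Conjecture 1 of Kontsevich–Zagier, kernel form, for WEIGHT TWO OFF RESONANCE, ALL LEVELS** —
unconditionally: a formal `ℤ`-combination of boxes `[(0,1)², c x^a y^b/(1 − x^{k₁}y^{k₂})]`
(`c ∈ ℚ`, `k₁, k₂ ≥ 1`, `(a+1)k₂ ≠ (b+1)k₁`) and of rational representations of dimension `≤ 1`,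
with value `0`, is a relation: three moves per box (rules 2, 2, 3) into dimension one, then Baker
(seat c4's `Dlog.mem_relations_of_eval_eq_zero_of_dim_le_one`). The diagonal/resonant boxes are the
route's sectors `(2, K)`, whose rigidity inputs are level-dependent; this is their complement.
[cite: KontsevichZagier2001, §1.2 Conjecture 1] -/
theorem offres_mem_relations_of_eval_eq_zero_of_mem_closure {x : FormalRep}
    (hx : x ∈ AddSubgroup.closure
      ({y : FormalRep | ∃ (k₁ k₂ a b : ℕ) (c : ℚ) (N : IntegralRep 2), 0 < k₁ ∧ 0 < k₂ ∧
          (a + 1) * k₂ ≠ (b + 1) * k₁ ∧ N.domain = {x | ∀ i, x i ∈ Set.Ioo (0:ℝ) 1} ∧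
          EqOn N.integrand (fun x => (c : ℝ) * (x 0 ^ a * x 1 ^ b) / (1 - x 0 ^ k₁ * x 1 ^ k₂))
            N.domain ∧ y = of N} ∪
       {y : FormalRep | ∃ (m : ℕ) (N : IntegralRep m), m ≤ 1 ∧ N.IsRational ∧ y = of N}))
    (hv : eval x = 0) : x ∈ relations := by
  obtain ⟨x', hx', e⟩ := exists_mem_dimLeOneClosure_of_mem_offresClosure hx
  have h0 : eval x' = 0 := by
    have h := relations_le_ker_eval_holds e
    rw [AddMonoidHom.mem_ker, map_sub, hv, zero_sub, neg_eq_zero] at h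
    exact h
  have hx'r := mem_relations_of_eval_eq_zero_of_dim_le_one hx' h0
  have e' : x = (x - x') + x' := by abel
  rw [e']
  exact relations.add_mem e hx'r

/-- **Two off-resonance boxes with equal values are KZ-equivalent** (any levels; unconditionally).
[cite: KontsevichZagier2001, §1.2 Conjecture 1] -/
theorem offres_equivalent_of_value_eq (k₁ k₂ a b k₁' k₂' a' b' : ℕ) (c c' : ℚ)
    (hk₁ : 0 < k₁) (hk₂ : 0 < k₂) (hres : (a + 1) * k₂ ≠ (b + 1) * k₁)
    (hk₁' : 0 < k₁') (hk₂' : 0 < k₂') (hres' : (a' + 1) * k₂' ≠ (b' + 1) * k₁')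
    (N N' : IntegralRep 2) (hNd : N.domain = {x | ∀ i, x i ∈ Set.Ioo (0:ℝ) 1})
    (hNi : EqOn N.integrand (fun x => (c : ℝ) * (x 0 ^ a * x 1 ^ b) / (1 - x 0 ^ k₁ * x 1 ^ k₂)) N.domain)
    (hN'd : N'.domain = {x | ∀ i, x i ∈ Set.Ioo (0:ℝ) 1})
    (hN'i : EqOn N'.integrand
      (fun x => (c' : ℝ) * (x 0 ^ a' * x 1 ^ b') / (1 - x 0 ^ k₁' * x 1 ^ k₂')) N'.domain)
    (hv : N.value = N'.value) : Equivalent N N' := by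
  refine offres_mem_relations_of_eval_eq_zero_of_mem_closure (AddSubgroup.sub_mem _
    (AddSubgroup.subset_closure (Or.inl ⟨k₁, k₂, a, b, c, N, hk₁, hk₂, hres, hNd, hNi, rfl⟩))
    (AddSubgroup.subset_closure (Or.inl ⟨k₁', k₂', a', b', c', N', hk₁', hk₂', hres', hN'd, hN'i, rfl⟩)))
    ?_
  rw [map_sub, eval_of, eval_of, hv, sub_self]

/-- **An off-resonance box against ANY rational representation of dimension `≤ 1`** — e.g.
`∫∫_{(0,1)²} dxdy/(1 − xy²) = 2 log 2` against `∫_1^4 dt/t`: equal values imply KZ-equivalence,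
unconditionally. [cite: KontsevichZagier2001, §1.2 Conjecture 1] -/
theorem offres_equivalent_dimLeOne_of_value_eq {m : ℕ} (hm : m ≤ 1) (k₁ k₂ a b : ℕ) (c : ℚ)
    (hk₁ : 0 < k₁) (hk₂ : 0 < k₂) (hres : (a + 1) * k₂ ≠ (b + 1) * k₁)
    (N : IntegralRep 2) (M : IntegralRep m) (hM : M.IsRational)
    (hNd : N.domain = {x | ∀ i, x i ∈ Set.Ioo (0:ℝ) 1})
    (hNi : EqOn N.integrand (fun x => (c : ℝ) * (x 0 ^ a * x 1 ^ b) / (1 - x 0 ^ k₁ * x 1 ^ k₂)) N.domain)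
    (hv : N.value = M.value) : Equivalent N M := by
  refine offres_mem_relations_of_eval_eq_zero_of_mem_closure (AddSubgroup.sub_mem _
    (AddSubgroup.subset_closure (Or.inl ⟨k₁, k₂, a, b, c, N, hk₁, hk₂, hres, hNd, hNi, rfl⟩))
    (AddSubgroup.subset_closure (Or.inr ⟨m, M, hm, hM, rfl⟩))) ?_
  rw [map_sub, eval_of, eval_of, hv, sub_self]

end Summit.KontsevichZagierPeriods.HurwitzMicroSectors.NormalFormPrinciple.PiBox.LevelK
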